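import Summits.BirchSwinnertonDyer.BirchSwinnertonDyer.Theorems.KatoDescentPotSupersingularKatoFiniteLevelStrictFinite
import HarnessLib

/-!
# Kato's (14.9.3) at finite level, part 10: the final counts in the LEVEL DIALECT of the `Kato2004` files —
# `E[p^k] = W.torsionGaloisModule ((p : ℤ) ^ k)` (as in `Kato2004.reduceH1Pk`, `locModPk`, `integralH1`) instead of
# `((p ^ k : ℕ) : ℤ)` (X11b `PrimaryInclusionLevels` and parts 1–9)
# (route `KatoDescentPotSupersingular` / `…Tame…`, crux M = stmt-BirchSwinnertonDyer-19196; route-free helper)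

Seat `bsd-potss-rkm` g17 (prover; cell `bsd-potss`), item stmt-BirchSwinnertonDyer-19196 `ReducibleKatoMember`
(`--supports … --as helper`; closes nothing).  HONEST FRAMING: BSD is not proved by any of this; nothing is booked;
theorems only (no definition, no named fact).  The two level spellings agree by `Nat.cast_pow`; this file only transports the
statements of part 9 (`…StrictFinite`) so that the author of the COMPACT half of Kato's (14.9.3) — who works with
`Kato2004.reduceH1Pk : H¹(U, T_pE) → H¹(U, E[p^k])` and `Kato2004.locModPk`, both typed with `(p : ℤ) ^ k` — can quote the count
without a dependent rewrite.

* `exists_forall_le_natCard_selmerGroup_relaxed_eq_of_finite_selmerGroupPInfty_intPow` (any `K : Type`),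
* `exists_forall_le_natCard_selmerGroup_relaxed_eq_rat_of_finite_selmerGroupPInfty_intPow` (`K = ℚ`, `P = {v_p}`):
  `∃ k₀ ∀ k ≥ k₀`, for every Poitou–Tate family at level `p^k` and every Kato pair `𝓢 ≤ ℛ` on `W.torsionGaloisModule ((p:ℤ)^k)`:
  `#H¹_ℛ = #Sel_str^{ur}(K,E[p^∞]) · ∏_{v∈P} #𝓚_v` (over `ℚ`: `· #E(ℚ_p)[p^k] · p^k`), hypotheses `[Finite (W.selmerGroupPInfty p)]`,
  `T`-data, `p` odd.

References: K. Kato, Astérisque 295 (2004) §13.8, (14.9.3), Prop. 14.16 [Kato2004Asterisque].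
-/

-- the summit and its single problem are both named `BirchSwinnertonDyer` (registry layout D-0017)
set_option linter.dupNamespace false
set_option autoImplicit false

noncomputable section

open scoped Classical ContRepresentation NumberField
open Function Field NumberField IsDedekindDomain WeierstrassCurve
open Literature.NumberTheory.EllipticCurves Literature.NumberTheory.GaloisRepresentations
  Literature.NumberTheory.GaloisRepresentations.DiscreteGaloisModule Literature.NumberTheory.GaloisCohomology
open Literature.NumberTheory.EllipticCurves.Kato2004
open Summit.BirchSwinnertonDyer.Rank1Residual.X11b.LocBridge

namespace Summit.BirchSwinnertonDyer.BirchSwinnertonDyer.Theorems.KatoFiniteLevelCount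

section KatoDialect

variable {K : Type} [Field K] [NumberField K] (W : WeierstrassCurve K) [W.IsElliptic] (p : ℕ) [Fact p.Prime]

/-- **Kato's (14.9.3) count, `Kato2004` level dialect `(p : ℤ) ^ k`, any number field `K : Type`.** Part 9's
`exists_forall_le_natCard_selmerGroup_relaxed_eq_of_finite_selmerGroupPInfty` transported along `((p ^ k : ℕ) : ℤ) = (p : ℤ) ^ k`
(`Nat.cast_pow`). [cite: Kato2004Asterisque, (14.9.3)–(14.9.4) (p. 240) and Prop. 14.16 (p. 244)] -/
theorem exists_forall_le_natCard_selmerGroup_relaxed_eq_of_finite_selmerGroupPInfty_intPow (hodd : p ≠ 2)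
    (P T : Finset (HeightOneSpectrum (𝓞 K)))
    (hPT : P ⊆ T) (hT : ∀ v : HeightOneSpectrum (𝓞 K), v ∉ T → (p : 𝓞 K) ∉ v.asIdeal ∧ W.HasGoodReductionAt v)
    (hPp : ∀ v : HeightOneSpectrum (𝓞 K), (p : 𝓞 K) ∈ v.asIdeal → v ∈ P)
    (𝓢inf : SelmerStructure (primaryGaloisModule W p)) [Finite (W.selmerGroupPInfty p)]
    (hIP : ∀ v ∈ P, 𝓢inf (Sum.inr v) = ⊥)
    (hIur : ∀ v ∉ P, 𝓢inf (Sum.inr v) = unramifiedSubgroup (GaloisRep.toLocal v (primaryGaloisModule W p)) 1)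
    (hIinl : ∀ w : InfinitePlace K, 𝓢inf (Sum.inl w) = ⊤) {v₀ : HeightOneSpectrum (𝓞 K)} (hv₀P : v₀ ∈ P) :
    ∃ k₀ : ℕ, ∀ k, k₀ ≤ k →
      ∀ (inv : LocalInvariants K (p ^ k)), inv.IsPerfect → inv.SumLocalTermEqZero → inv.SelmerComplement →
      ∀ (𝓢 ℛ : SelmerStructure (W.torsionGaloisModule ((p : ℤ) ^ k))),
        (∀ v ∈ P, 𝓢 (Sum.inr v) = ⊥) → (∀ v ∈ P, ℛ (Sum.inr v) = ⊤) →
        (∀ v ∉ P, 𝓢 (Sum.inr v) = unramifiedSubgroup (GaloisRep.toLocal v (W.torsionGaloisModule ((p : ℤ) ^ k))) 1) →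
        (∀ v ∉ P, ℛ (Sum.inr v) = unramifiedSubgroup (GaloisRep.toLocal v (W.torsionGaloisModule ((p : ℤ) ^ k))) 1) →
        Nat.card ℛ.selmerGroup =
          Nat.card 𝓢inf.selmerGroup * ∏ v ∈ P, Nat.card (W.kummerSelmerStructure ((p : ℤ) ^ k) (Sum.inr v)) := by
  obtain ⟨k₀, hk₀⟩ := exists_forall_le_natCard_selmerGroup_relaxed_eq_of_finite_selmerGroupPInfty W p hodd P T hPT hT
    hPp 𝓢inf hIP hIur hIinl hv₀P
  refine ⟨k₀, fun k hk => ?_⟩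
  rw [← Nat.cast_pow]
  exact hk₀ k hk

/-- **Kato's (14.9.3) count over `ℚ`, `Kato2004` level dialect `(p : ℤ) ^ k`**: `∃ k₀ ∀ k ≥ k₀`, for every Poitou–Tate family at
level `p^k` and every Kato pair `𝓢 ≤ ℛ` on `W.torsionGaloisModule ((p:ℤ)^k)` (zero / everything at `v_p`, unramified at every other
prime), **`#H¹_ℛ(ℚ, E[p^k]) = #Sel_str^{ur}(ℚ, E[p^∞]) · #E(ℚ_{v_p})[p^k] · p^k`**, given `[Finite (W.selmerGroupPInfty p)]`.
[cite: Kato2004Asterisque, (14.9.3)–(14.9.4) (p. 240) and Prop. 14.16 (p. 244)] -/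
theorem exists_forall_le_natCard_selmerGroup_relaxed_eq_rat_of_finite_selmerGroupPInfty_intPow (W : WeierstrassCurve ℚ)
    [W.IsElliptic] (hodd : p ≠ 2)
    (T : Finset (HeightOneSpectrum (𝓞 ℚ))) (hpT : primePlace p ∈ T)
    (hT : ∀ v : HeightOneSpectrum (𝓞 ℚ), v ∉ T → W.HasGoodReductionAt v)
    (𝓢inf : SelmerStructure (primaryGaloisModule W p)) [Finite (W.selmerGroupPInfty p)]
    (hIP : 𝓢inf (Sum.inr (primePlace p)) = ⊥)
    (hIur : ∀ v : HeightOneSpectrum (𝓞 ℚ), v ≠ primePlace p →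
      𝓢inf (Sum.inr v) = unramifiedSubgroup (GaloisRep.toLocal v (primaryGaloisModule W p)) 1)
    (hIinl : ∀ w : InfinitePlace ℚ, 𝓢inf (Sum.inl w) = ⊤) :
    ∃ k₀ : ℕ, ∀ k, k₀ ≤ k →
      ∀ (inv : LocalInvariants ℚ (p ^ k)), inv.IsPerfect → inv.SumLocalTermEqZero → inv.SelmerComplement →
      ∀ (𝓢 ℛ : SelmerStructure (W.torsionGaloisModule ((p : ℤ) ^ k))),
        𝓢 (Sum.inr (primePlace p)) = ⊥ → ℛ (Sum.inr (primePlace p)) = ⊤ →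
        (∀ v : HeightOneSpectrum (𝓞 ℚ), v ≠ primePlace p →
          𝓢 (Sum.inr v) = unramifiedSubgroup (GaloisRep.toLocal v (W.torsionGaloisModule ((p : ℤ) ^ k))) 1) →
        (∀ v : HeightOneSpectrum (𝓞 ℚ), v ≠ primePlace p →
          ℛ (Sum.inr v) = unramifiedSubgroup (GaloisRep.toLocal v (W.torsionGaloisModule ((p : ℤ) ^ k))) 1) →
        Nat.card ℛ.selmerGroup =
          Nat.card 𝓢inf.selmerGroup *
            (Nat.card (nsmulAddMonoidHom (p ^ k) :
              (W.baseChange ((primePlace p).adicCompletion ℚ)).toAffine.Point →+ _).ker * p ^ k) := by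
  obtain ⟨k₀, hk₀⟩ := exists_forall_le_natCard_selmerGroup_relaxed_eq_rat_of_finite_selmerGroupPInfty W p hodd T hpT
    hT 𝓢inf hIP hIur hIinl
  refine ⟨k₀, fun k hk => ?_⟩
  rw [← Nat.cast_pow]
  exact hk₀ k hk

end KatoDialect

end Summit.BirchSwinnertonDyer.BirchSwinnertonDyer.Theorems.KatoFiniteLevelCount

end
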